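import Summits.Ventures.Crystal3D.Theorems.StickyWulffConstantNoReconstructionGainOffLattice
import HarnessLib

/-!
# Single-vacancy rigidity of the fcc kissing shell (first riser atom of the wall ledger)

HONEST FRAMING. Part of the venture `Summits/Ventures/Crystal3D` (cell `crystal3d-full`), helper
`--supports` the crux `CoaxialWallLaw` (stmt-Ventures-19481, `route-Ventures-StickyWulffConstant`),
REGISTERED line `WallLedgerF` (planner cf-p1 gen 16; memo HOME/cf-p1/ROUTE.md §68), stub
`stub_coaxialTwoSlabAdhesion` (terrace/riser slot ledger); equally usable by line `WallLedgerG`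
(stmt-Ventures-19480).  Continues the cubic-frame files `…NoReconstructionGainCubicFrame` /
`…NoReconstructionGainOffLattice` (L3′).

**Theorem (`fcc_single_vacancy`).**  Let `q` be a site of the model fcc lattice
`Λ₀ = fccStacking 1 √(2/3)` and `z₀` one of its twelve nearest-neighbour sites.  If a point `y`
touches `q` (`dist q y = 1`) and keeps distance `≥ 1` from the eleven OTHER nearest-neighbour
sites of `q`, then `y = z₀`.  In ledger language: a lattice ball whose twelve slots are occupied
except one has NO contact outside its slots — its single vacancy cannot be compensated by any
ball of the other grain (or by any off-lattice ball): it contributes exactly `½` to the deficiency.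
This is the `k = 1` case of the riser ledger's absorption inequality (this seat's evidence on
stmt-Ventures-19481); `fcc_single_vacancy_moved` transports it to a moved lattice `A·Λ₀ + t`.

Proof (`cubicShell_single_vacancy_base`): in the cubic frame (`2‖p‖² = A² + B² + C²`, sites =
even-sum integer triples, slots = the twelve `(±1,±1,0)`-type triples) the hypotheses for the slot
`v = (1,1,0)` read `a² + b² + c² = 2` and `⟨(a,b,c), s⟩ ≤ 1` for the eleven other slots `s`; the
eight mixed slots give `|a|, |b| ≤ 1 − |c|`, whence `2 ≤ 2(1 − |c|)² + c²`, i.e. `|c|(3|c| − 4) ≥ 0`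
with `|c| ≤ 1`, so `c = 0`, `a² = b² = 1`, and the three slots `(±1,∓1,0), (−1,−1,0)` leave only
`(a,b) = (1,1)`.  The other eleven slots follow by the signed coordinate permutations of `D₃`
(`cubicShell_single_vacancy`, twelve mechanical cases).
WHAT THIS IS NOT: two or more vacancies (lens / ribbon lemmas); the stub; rung F-C1 not moved.
-/

noncomputable section

namespace Summit.Ventures.Crystal3D.Theorems

open Summit.Ventures.Crystal3D Finset
open Literature.MathematicalPhysics.StatisticalMechanics (barlowPos barlowStacking fccStacking
  constHagg haggLabel_const barlowPos_mem)

/-- **Single-vacancy rigidity, base slot `(1,1,0)`** (cubic coordinates of `D₃`): norm² `2` and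
inner product `≤ 1` with the eleven first-neighbour vectors other than `(1,1,0)` force
`(a, b, c) = (1, 1, 0)`. -/
theorem cubicShell_single_vacancy_base (x y z : ℝ) (h2 : x ^ 2 + y ^ 2 + z ^ 2 = 2)
    (h1 : x - y ≤ 1)
    (h2 : - x + y ≤ 1)
    (h3 : - x - y ≤ 1)
    (h4 : x + z ≤ 1)
    (h5 : x - z ≤ 1)
    (h6 : - x + z ≤ 1)
    (h7 : - x - z ≤ 1)
    (h8 : y + z ≤ 1)
    (h9 : y - z ≤ 1)
    (h10 : - y + z ≤ 1)
    (h11 : - y - z ≤ 1) :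
    x = 1 ∧ y = 1 ∧ z = 0 := by
  -- `|x|, |y| ≤ 1 - |z|`, hence `z = 0`
  have hz : z = 0 := by
    rcases le_total 0 z with hz0 | hz0
    · -- slots (±1,0,1), (0,±1,1): |x|, |y| ≤ 1 - z
      have p1 : 0 ≤ (1 - z - x) * (1 - z + x) := mul_nonneg (by linarith) (by linarith)
      have p2 : 0 ≤ (1 - z - y) * (1 - z + y) := mul_nonneg (by linarith) (by linarith)
      have hz1 : z ≤ 1 := by linarith
      have hle : z * (4 - 3 * z) ≤ 0 := by nlinarith [p1, p2, h2]
      have hge : 0 ≤ z * (4 - 3 * z) := mul_nonneg hz0 (by linarith)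
      rcases mul_eq_zero.1 (le_antisymm hle hge) with h | h
      · exact h
      · exfalso; linarith
    · -- slots (±1,0,-1), (0,±1,-1): |x|, |y| ≤ 1 + z
      have p1 : 0 ≤ (1 + z - x) * (1 + z + x) := mul_nonneg (by linarith) (by linarith)
      have p2 : 0 ≤ (1 + z - y) * (1 + z + y) := mul_nonneg (by linarith) (by linarith)
      have hz1 : -1 ≤ z := by linarith
      have hle : (-z) * (4 + 3 * z) ≤ 0 := by nlinarith [p1, p2, h2]
      have hge : 0 ≤ (-z) * (4 + 3 * z) := mul_nonneg (by linarith) (by linarith)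
      rcases mul_eq_zero.1 (le_antisymm hle hge) with h | h
      · linarith
      · exfalso; linarith
  subst hz
  have hx1 : x ^ 2 ≤ 1 := by
    have p1 : 0 ≤ (1 - 0 - x) * (1 - 0 + x) := mul_nonneg (by linarith) (by linarith)
    nlinarith [p1]
  have hy1 : y ^ 2 ≤ 1 := by
    have p2 : 0 ≤ (1 - 0 - y) * (1 - 0 + y) := mul_nonneg (by linarith) (by linarith)
    nlinarith [p2]
  have hx2 : x ^ 2 = 1 := by nlinarith
  have hy2 : y ^ 2 = 1 := by nlinarith
  have hx : x = 1 ∨ x = -1 := by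
    have : (x - 1) * (x + 1) = 0 := by nlinarith
    rcases mul_eq_zero.1 this with h | h
    · left; linarith
    · right; linarith
  have hy : y = 1 ∨ y = -1 := by
    have : (y - 1) * (y + 1) = 0 := by nlinarith
    rcases mul_eq_zero.1 this with h | h
    · left; linarith
    · right; linarith
  rcases hx with hx | hx <;> rcases hy with hy | hy <;> subst hx <;> subst hy
  · exact ⟨rfl, rfl, rfl⟩
  · exfalso; linarith
  · exfalso; linarith
  · exfalso; linarith

/-- **Single-vacancy rigidity of the fcc kissing shell, general slot** (cubic coordinates).  If
`(a, b, c)` has norm² `2` and inner product `≤ 1` with every first-neighbour vector of the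
checkerboard lattice `D₃` except possibly `v`, then `(a, b, c) = v`. -/
theorem cubicShell_single_vacancy (a b c : ℝ) (h2 : a ^ 2 + b ^ 2 + c ^ 2 = 2) (v : ℤ × ℤ × ℤ)
    (hv : v ∈ ([((1 : ℤ), (1 : ℤ), (0 : ℤ)), (1, -1, 0), (-1, 1, 0), (-1, -1, 0), (1, 0, 1), (1, 0, -1),
        (-1, 0, 1), (-1, 0, -1), (0, 1, 1), (0, 1, -1), (0, -1, 1), (0, -1, -1)] : List (ℤ × ℤ × ℤ)))
    (h : ∀ s ∈ ([((1 : ℤ), (1 : ℤ), (0 : ℤ)), (1, -1, 0), (-1, 1, 0), (-1, -1, 0), (1, 0, 1), (1, 0, -1),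
        (-1, 0, 1), (-1, 0, -1), (0, 1, 1), (0, 1, -1), (0, -1, 1), (0, -1, -1)] : List (ℤ × ℤ × ℤ)), s ≠ v →
      a * (s.1 : ℝ) + b * (s.2.1 : ℝ) + c * (s.2.2 : ℝ) ≤ 1) :
    a = (v.1 : ℝ) ∧ b = (v.2.1 : ℝ) ∧ c = (v.2.2 : ℝ) := by
  simp only [List.mem_cons, List.mem_nil_iff, or_false] at hv
  rcases hv with rfl | rfl | rfl | rfl | rfl | rfl | rfl | rfl | rfl | rfl | rfl | rfl
  · -- v = (1, 1, 0)
    simp only [List.forall_mem_cons, ne_eq, Prod.mk.injEq] at h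
    norm_num at h
    obtain ⟨g1, g2, g3, g4, g5, g6, g7, g8, g9, g10, g11⟩ := h
    have hsq : (a) ^ 2 + (b) ^ 2 + (c) ^ 2 = 2 := by nlinarith [h2]
    obtain ⟨e1, e2, e3⟩ := cubicShell_single_vacancy_base (a) (b) (c) hsq
      (by linarith) (by linarith) (by linarith) (by linarith) (by linarith) (by linarith)
      (by linarith) (by linarith) (by linarith) (by linarith) (by linarith)
    refine ⟨?_, ?_, ?_⟩ <;> push_cast <;> linarith
  · -- v = (1, -1, 0)
    simp only [List.forall_mem_cons, ne_eq, Prod.mk.injEq] at h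
    norm_num at h
    obtain ⟨g1, g2, g3, g4, g5, g6, g7, g8, g9, g10, g11⟩ := h
    have hsq : (a) ^ 2 + (-b) ^ 2 + (c) ^ 2 = 2 := by nlinarith [h2]
    obtain ⟨e1, e2, e3⟩ := cubicShell_single_vacancy_base (a) (-b) (c) hsq
      (by linarith) (by linarith) (by linarith) (by linarith) (by linarith) (by linarith)
      (by linarith) (by linarith) (by linarith) (by linarith) (by linarith)
    refine ⟨?_, ?_, ?_⟩ <;> push_cast <;> linarith
  · -- v = (-1, 1, 0)
    simp only [List.forall_mem_cons, ne_eq, Prod.mk.injEq] at h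
    norm_num at h
    obtain ⟨g1, g2, g3, g4, g5, g6, g7, g8, g9, g10, g11⟩ := h
    have hsq : (-a) ^ 2 + (b) ^ 2 + (c) ^ 2 = 2 := by nlinarith [h2]
    obtain ⟨e1, e2, e3⟩ := cubicShell_single_vacancy_base (-a) (b) (c) hsq
      (by linarith) (by linarith) (by linarith) (by linarith) (by linarith) (by linarith)
      (by linarith) (by linarith) (by linarith) (by linarith) (by linarith)
    refine ⟨?_, ?_, ?_⟩ <;> push_cast <;> linarith
  · -- v = (-1, -1, 0)
    simp only [List.forall_mem_cons, ne_eq, Prod.mk.injEq] at h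
    norm_num at h
    obtain ⟨g1, g2, g3, g4, g5, g6, g7, g8, g9, g10, g11⟩ := h
    have hsq : (-a) ^ 2 + (-b) ^ 2 + (c) ^ 2 = 2 := by nlinarith [h2]
    obtain ⟨e1, e2, e3⟩ := cubicShell_single_vacancy_base (-a) (-b) (c) hsq
      (by linarith) (by linarith) (by linarith) (by linarith) (by linarith) (by linarith)
      (by linarith) (by linarith) (by linarith) (by linarith) (by linarith)
    refine ⟨?_, ?_, ?_⟩ <;> push_cast <;> linarith
  · -- v = (1, 0, 1)
    simp only [List.forall_mem_cons, ne_eq, Prod.mk.injEq] at h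
    norm_num at h
    obtain ⟨g1, g2, g3, g4, g5, g6, g7, g8, g9, g10, g11⟩ := h
    have hsq : (a) ^ 2 + (c) ^ 2 + (b) ^ 2 = 2 := by nlinarith [h2]
    obtain ⟨e1, e2, e3⟩ := cubicShell_single_vacancy_base (a) (c) (b) hsq
      (by linarith) (by linarith) (by linarith) (by linarith) (by linarith) (by linarith)
      (by linarith) (by linarith) (by linarith) (by linarith) (by linarith)
    refine ⟨?_, ?_, ?_⟩ <;> push_cast <;> linarith
  · -- v = (1, 0, -1)
    simp only [List.forall_mem_cons, ne_eq, Prod.mk.injEq] at h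
    norm_num at h
    obtain ⟨g1, g2, g3, g4, g5, g6, g7, g8, g9, g10, g11⟩ := h
    have hsq : (a) ^ 2 + (-c) ^ 2 + (b) ^ 2 = 2 := by nlinarith [h2]
    obtain ⟨e1, e2, e3⟩ := cubicShell_single_vacancy_base (a) (-c) (b) hsq
      (by linarith) (by linarith) (by linarith) (by linarith) (by linarith) (by linarith)
      (by linarith) (by linarith) (by linarith) (by linarith) (by linarith)
    refine ⟨?_, ?_, ?_⟩ <;> push_cast <;> linarith
  · -- v = (-1, 0, 1)
    simp only [List.forall_mem_cons, ne_eq, Prod.mk.injEq] at h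
    norm_num at h
    obtain ⟨g1, g2, g3, g4, g5, g6, g7, g8, g9, g10, g11⟩ := h
    have hsq : (-a) ^ 2 + (c) ^ 2 + (b) ^ 2 = 2 := by nlinarith [h2]
    obtain ⟨e1, e2, e3⟩ := cubicShell_single_vacancy_base (-a) (c) (b) hsq
      (by linarith) (by linarith) (by linarith) (by linarith) (by linarith) (by linarith)
      (by linarith) (by linarith) (by linarith) (by linarith) (by linarith)
    refine ⟨?_, ?_, ?_⟩ <;> push_cast <;> linarith
  · -- v = (-1, 0, -1)
    simp only [List.forall_mem_cons, ne_eq, Prod.mk.injEq] at h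
    norm_num at h
    obtain ⟨g1, g2, g3, g4, g5, g6, g7, g8, g9, g10, g11⟩ := h
    have hsq : (-a) ^ 2 + (-c) ^ 2 + (b) ^ 2 = 2 := by nlinarith [h2]
    obtain ⟨e1, e2, e3⟩ := cubicShell_single_vacancy_base (-a) (-c) (b) hsq
      (by linarith) (by linarith) (by linarith) (by linarith) (by linarith) (by linarith)
      (by linarith) (by linarith) (by linarith) (by linarith) (by linarith)
    refine ⟨?_, ?_, ?_⟩ <;> push_cast <;> linarith
  · -- v = (0, 1, 1)
    simp only [List.forall_mem_cons, ne_eq, Prod.mk.injEq] at h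
    norm_num at h
    obtain ⟨g1, g2, g3, g4, g5, g6, g7, g8, g9, g10, g11⟩ := h
    have hsq : (b) ^ 2 + (c) ^ 2 + (a) ^ 2 = 2 := by nlinarith [h2]
    obtain ⟨e1, e2, e3⟩ := cubicShell_single_vacancy_base (b) (c) (a) hsq
      (by linarith) (by linarith) (by linarith) (by linarith) (by linarith) (by linarith)
      (by linarith) (by linarith) (by linarith) (by linarith) (by linarith)
    refine ⟨?_, ?_, ?_⟩ <;> push_cast <;> linarith
  · -- v = (0, 1, -1)
    simp only [List.forall_mem_cons, ne_eq, Prod.mk.injEq] at h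
    norm_num at h
    obtain ⟨g1, g2, g3, g4, g5, g6, g7, g8, g9, g10, g11⟩ := h
    have hsq : (b) ^ 2 + (-c) ^ 2 + (a) ^ 2 = 2 := by nlinarith [h2]
    obtain ⟨e1, e2, e3⟩ := cubicShell_single_vacancy_base (b) (-c) (a) hsq
      (by linarith) (by linarith) (by linarith) (by linarith) (by linarith) (by linarith)
      (by linarith) (by linarith) (by linarith) (by linarith) (by linarith)
    refine ⟨?_, ?_, ?_⟩ <;> push_cast <;> linarith
  · -- v = (0, -1, 1)
    simp only [List.forall_mem_cons, ne_eq, Prod.mk.injEq] at h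
    norm_num at h
    obtain ⟨g1, g2, g3, g4, g5, g6, g7, g8, g9, g10, g11⟩ := h
    have hsq : (-b) ^ 2 + (c) ^ 2 + (a) ^ 2 = 2 := by nlinarith [h2]
    obtain ⟨e1, e2, e3⟩ := cubicShell_single_vacancy_base (-b) (c) (a) hsq
      (by linarith) (by linarith) (by linarith) (by linarith) (by linarith) (by linarith)
      (by linarith) (by linarith) (by linarith) (by linarith) (by linarith)
    refine ⟨?_, ?_, ?_⟩ <;> push_cast <;> linarith
  · -- v = (0, -1, -1)
    simp only [List.forall_mem_cons, ne_eq, Prod.mk.injEq] at h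
    norm_num at h
    obtain ⟨g1, g2, g3, g4, g5, g6, g7, g8, g9, g10, g11⟩ := h
    have hsq : (-b) ^ 2 + (-c) ^ 2 + (a) ^ 2 = 2 := by nlinarith [h2]
    obtain ⟨e1, e2, e3⟩ := cubicShell_single_vacancy_base (-b) (-c) (a) hsq
      (by linarith) (by linarith) (by linarith) (by linarith) (by linarith) (by linarith)
      (by linarith) (by linarith) (by linarith) (by linarith) (by linarith)
    refine ⟨?_, ?_, ?_⟩ <;> push_cast <;> linarith

/-- Parity and norm of the twelve slot triples (a `decide`). -/
theorem cubicShell_facts : ∀ s ∈ ([((1 : ℤ), (1 : ℤ), (0 : ℤ)), (1, -1, 0), (-1, 1, 0), (-1, -1, 0), (1, 0, 1), (1, 0, -1),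
        (-1, 0, 1), (-1, 0, -1), (0, 1, 1), (0, 1, -1), (0, -1, 1), (0, -1, -1)] : List (ℤ × ℤ × ℤ)),
    (s.1 + s.2.1 + s.2.2) % 2 = 0 ∧ s.1 ^ 2 + s.2.1 ^ 2 + s.2.2 ^ 2 = 2 := by
  decide

/-- The first-neighbour vectors of `D₃` (cubic coordinates of the twelve bond vectors of `Λ₀`):
an even-sum integer triple of norm² `2` is one of the twelve `(±1,±1,0)`-type triples. -/
theorem cubicShell_of_norm_sq_two (a b c : ℤ) (h : Even (a + b + c)) (hn : a ^ 2 + b ^ 2 + c ^ 2 = 2) :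
    (a, b, c) ∈ ([((1 : ℤ), (1 : ℤ), (0 : ℤ)), (1, -1, 0), (-1, 1, 0), (-1, -1, 0), (1, 0, 1), (1, 0, -1),
        (-1, 0, 1), (-1, 0, -1), (0, 1, 1), (0, 1, -1), (0, -1, 1), (0, -1, -1)] : List (ℤ × ℤ × ℤ)) := by
  rcases short_even_vectors a b c h (by omega) with h0 | h1 | h2
  · exfalso
    simp only [Prod.mk.injEq] at h0
    obtain ⟨rfl, rfl, rfl⟩ := h0
    norm_num at hn
  · exact h1
  · exfalso
    simp only [List.mem_cons, List.mem_nil_iff, or_false, Prod.mk.injEq] at h2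
    rcases h2 with ⟨rfl, rfl, rfl⟩ | ⟨rfl, rfl, rfl⟩ | ⟨rfl, rfl, rfl⟩ | ⟨rfl, rfl, rfl⟩ |
      ⟨rfl, rfl, rfl⟩ | ⟨rfl, rfl, rfl⟩ <;> norm_num at hn

/-- **A site at prescribed cubic offset.**  For a site `q = (k₀,i₀,j₀)` of `Λ₀` and an even-sum
integer triple `s`, the site `z = (k₀+k, i₀+i, j₀+j)` with `(i+j, i+k, j+k) = s` has cubic
coordinates `s` relative to `q`, and `2·dist(q,z)² = |s|²`. -/
theorem exists_site_at_cubic_offset (k₀ i₀ j₀ : ℤ) (s : ℤ × ℤ × ℤ) (hs : Even (s.1 + s.2.1 + s.2.2)) :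
    ∃ z ∈ fccStacking 1 (Real.sqrt (2 / 3)),
      (z - barlowPos 1 (Real.sqrt (2 / 3)) constHagg k₀ i₀ j₀) 0 +
          Real.sqrt 3 / 3 * (z - barlowPos 1 (Real.sqrt (2 / 3)) constHagg k₀ i₀ j₀) 1 -
          Real.sqrt (2 / 3) * (z - barlowPos 1 (Real.sqrt (2 / 3)) constHagg k₀ i₀ j₀) 2 = s.1 ∧
      (z - barlowPos 1 (Real.sqrt (2 / 3)) constHagg k₀ i₀ j₀) 0 -
          Real.sqrt 3 / 3 * (z - barlowPos 1 (Real.sqrt (2 / 3)) constHagg k₀ i₀ j₀) 1 +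
          Real.sqrt (2 / 3) * (z - barlowPos 1 (Real.sqrt (2 / 3)) constHagg k₀ i₀ j₀) 2 = s.2.1 ∧
      2 * Real.sqrt 3 / 3 * (z - barlowPos 1 (Real.sqrt (2 / 3)) constHagg k₀ i₀ j₀) 1 +
          Real.sqrt (2 / 3) * (z - barlowPos 1 (Real.sqrt (2 / 3)) constHagg k₀ i₀ j₀) 2 = s.2.2 ∧
      2 * dist (barlowPos 1 (Real.sqrt (2 / 3)) constHagg k₀ i₀ j₀) z ^ 2 =
        (s.1 : ℝ) ^ 2 + (s.2.1 : ℝ) ^ 2 + (s.2.2 : ℝ) ^ 2 := by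
  obtain ⟨k, i, j, hij, hik, hjk⟩ := barlowPos_of_cubic s.1 s.2.1 s.2.2 hs
  refine ⟨barlowPos 1 (Real.sqrt (2 / 3)) constHagg (k₀ + k) (i₀ + i) (j₀ + j), barlowPos_mem _ _ _, ?_⟩
  have hsub : barlowPos 1 (Real.sqrt (2 / 3)) constHagg (k₀ + k) (i₀ + i) (j₀ + j) -
      barlowPos 1 (Real.sqrt (2 / 3)) constHagg k₀ i₀ j₀ = barlowPos 1 (Real.sqrt (2 / 3)) constHagg k i j := by
    rw [barlowPos_fcc_sub]; congr 1 <;> ring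
  obtain ⟨hA, hB, hC⟩ := cubic_barlowPos k i j
  have ha : (s.1 : ℝ) = i + j := by exact_mod_cast hij.symm
  have hb : (s.2.1 : ℝ) = i + k := by exact_mod_cast hik.symm
  have hc : (s.2.2 : ℝ) = j + k := by exact_mod_cast hjk.symm
  rw [hsub, ha, hb, hc]
  refine ⟨hA, hB, hC, ?_⟩
  rw [dist_comm, dist_eq_norm, hsub, two_mul_norm_sq_eq_cubic, hA, hB, hC]

/-- Cubic coordinates of a nearest-neighbour site: if `z ∈ Λ₀` is at distance `1` from the site
`q = (k₀,i₀,j₀)`, its cubic coordinates relative to `q` form one of the twelve slot triples. -/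
theorem cubic_of_unit_neighbour (z : EuclideanSpace ℝ (Fin 3)) (hz : z ∈ fccStacking 1 (Real.sqrt (2 / 3)))
    (k₀ i₀ j₀ : ℤ) (hd : dist (barlowPos 1 (Real.sqrt (2 / 3)) constHagg k₀ i₀ j₀) z = 1) :
    ∃ v ∈ ([((1 : ℤ), (1 : ℤ), (0 : ℤ)), (1, -1, 0), (-1, 1, 0), (-1, -1, 0), (1, 0, 1), (1, 0, -1),
        (-1, 0, 1), (-1, 0, -1), (0, 1, 1), (0, 1, -1), (0, -1, 1), (0, -1, -1)] : List (ℤ × ℤ × ℤ)),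
      (z - barlowPos 1 (Real.sqrt (2 / 3)) constHagg k₀ i₀ j₀) 0 +
          Real.sqrt 3 / 3 * (z - barlowPos 1 (Real.sqrt (2 / 3)) constHagg k₀ i₀ j₀) 1 -
          Real.sqrt (2 / 3) * (z - barlowPos 1 (Real.sqrt (2 / 3)) constHagg k₀ i₀ j₀) 2 = v.1 ∧
      (z - barlowPos 1 (Real.sqrt (2 / 3)) constHagg k₀ i₀ j₀) 0 -
          Real.sqrt 3 / 3 * (z - barlowPos 1 (Real.sqrt (2 / 3)) constHagg k₀ i₀ j₀) 1 +
          Real.sqrt (2 / 3) * (z - barlowPos 1 (Real.sqrt (2 / 3)) constHagg k₀ i₀ j₀) 2 = v.2.1 ∧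
      2 * Real.sqrt 3 / 3 * (z - barlowPos 1 (Real.sqrt (2 / 3)) constHagg k₀ i₀ j₀) 1 +
          Real.sqrt (2 / 3) * (z - barlowPos 1 (Real.sqrt (2 / 3)) constHagg k₀ i₀ j₀) 2 = v.2.2 := by
  obtain ⟨Z, hZe, hZA, hZB, hZC⟩ := cubic_site_sub z hz k₀ i₀ j₀
  have h2 := two_mul_norm_sq_eq_cubic (z - barlowPos 1 (Real.sqrt (2 / 3)) constHagg k₀ i₀ j₀)
  rw [← dist_eq_norm, dist_comm, hd, one_pow, mul_one, hZA, hZB, hZC] at h2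
  have hn' : ((Z.1 ^ 2 + Z.2.1 ^ 2 + Z.2.2 ^ 2 : ℤ) : ℝ) = 2 := by push_cast; linarith
  have hn : Z.1 ^ 2 + Z.2.1 ^ 2 + Z.2.2 ^ 2 = 2 := by exact_mod_cast hn'
  exact ⟨Z, cubicShell_of_norm_sq_two _ _ _ hZe hn, hZA, hZB, hZC⟩

/-- **Single-vacancy rigidity of the fcc shell (`Λ₀` form).**  `q, z₀ ∈ Λ₀` with
`dist q z₀ = 1`; if `y` touches `q` and is at distance `≥ 1` from every nearest-neighbour site of
`q` other than `z₀`, then `y = z₀`.  (A lattice ball with eleven occupied slots has no twelfth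
contact except in its last slot.) -/
theorem fcc_single_vacancy (q y z₀ : EuclideanSpace ℝ (Fin 3))
    (hq : q ∈ fccStacking 1 (Real.sqrt (2 / 3))) (hz₀ : z₀ ∈ fccStacking 1 (Real.sqrt (2 / 3)))
    (hqz₀ : dist q z₀ = 1) (hy : dist q y = 1)
    (h : ∀ z ∈ fccStacking 1 (Real.sqrt (2 / 3)), dist q z = 1 → z ≠ z₀ → 1 ≤ dist y z) :
    y = z₀ := by
  obtain ⟨k₀, i₀, j₀, rfl⟩ := hq
  set q := barlowPos 1 (Real.sqrt (2 / 3)) constHagg k₀ i₀ j₀ with hqdef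
  -- cubic coordinates of `y - q`
  set a : ℝ := (y - q) 0 + Real.sqrt 3 / 3 * (y - q) 1 - Real.sqrt (2 / 3) * (y - q) 2 with ha
  set b : ℝ := (y - q) 0 - Real.sqrt 3 / 3 * (y - q) 1 + Real.sqrt (2 / 3) * (y - q) 2 with hb
  set c : ℝ := 2 * Real.sqrt 3 / 3 * (y - q) 1 + Real.sqrt (2 / 3) * (y - q) 2 with hc
  have h2 : a ^ 2 + b ^ 2 + c ^ 2 = 2 := by
    have h := two_mul_norm_sq_eq_cubic (y - q)
    rw [← dist_eq_norm, dist_comm, hy] at h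
    rw [ha, hb, hc]; linarith
  -- cubic coordinates `v` of `z₀ - q`
  obtain ⟨v, hv, hvA, hvB, hvC⟩ := cubic_of_unit_neighbour z₀ hz₀ k₀ i₀ j₀ hqz₀
  -- every other slot `s` is a site at distance `1` from `q`, distinct from `z₀`
  have hslots : ∀ s ∈ ([((1 : ℤ), (1 : ℤ), (0 : ℤ)), (1, -1, 0), (-1, 1, 0), (-1, -1, 0), (1, 0, 1), (1, 0, -1),
        (-1, 0, 1), (-1, 0, -1), (0, 1, 1), (0, 1, -1), (0, -1, 1), (0, -1, -1)] : List (ℤ × ℤ × ℤ)), s ≠ v →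
      a * (s.1 : ℝ) + b * (s.2.1 : ℝ) + c * (s.2.2 : ℝ) ≤ 1 := by
    intro s hs hsv
    obtain ⟨hsmod, hsn0⟩ := cubicShell_facts s hs
    have hse : Even (s.1 + s.2.1 + s.2.2) := Int.even_iff.2 hsmod
    have hsn : (s.1 : ℝ) ^ 2 + (s.2.1 : ℝ) ^ 2 + (s.2.2 : ℝ) ^ 2 = 2 := by exact_mod_cast hsn0
    obtain ⟨z, hzΛ, hzA, hzB, hzC, hzd⟩ := exists_site_at_cubic_offset k₀ i₀ j₀ s hse
    rw [hsn] at hzd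
    have hqz : dist q z = 1 := by
      have hsq1 : dist q z ^ 2 = 1 := by linarith
      exact (pow_eq_one_iff_of_nonneg dist_nonneg two_ne_zero).1 hsq1
    have hzz₀ : z ≠ z₀ := by
      intro hzz
      apply hsv
      rw [hzz] at hzA hzB hzC
      have e1 : (s.1 : ℝ) = v.1 := by rw [← hzA, hvA]
      have e2 : (s.2.1 : ℝ) = v.2.1 := by rw [← hzB, hvB]
      have e3 : (s.2.2 : ℝ) = v.2.2 := by rw [← hzC, hvC]
      have e1' : s.1 = v.1 := by exact_mod_cast e1
      have e2' : s.2.1 = v.2.1 := by exact_mod_cast e2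
      have e3' : s.2.2 = v.2.2 := by exact_mod_cast e3
      exact Prod.ext e1' (Prod.ext e2' e3')
    have hyz := h z hzΛ hqz hzz₀
    -- `2 ≤ 2·dist(y,z)² = (a - s₁)² + (b - s₂)² + (c - s₃)²`
    have hsph : (a - s.1) ^ 2 + (b - s.2.1) ^ 2 + (c - s.2.2) ^ 2 = 2 * dist y z ^ 2 := by
      have h := two_mul_norm_sq_eq_cubic (y - z)
      have eA : (y - z) 0 + Real.sqrt 3 / 3 * (y - z) 1 - Real.sqrt (2 / 3) * (y - z) 2 = a - s.1 := by
        rw [ha, ← hzA]; simp only [PiLp.sub_apply]; ring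
      have eB : (y - z) 0 - Real.sqrt 3 / 3 * (y - z) 1 + Real.sqrt (2 / 3) * (y - z) 2 = b - s.2.1 := by
        rw [hb, ← hzB]; simp only [PiLp.sub_apply]; ring
      have eC : 2 * Real.sqrt 3 / 3 * (y - z) 1 + Real.sqrt (2 / 3) * (y - z) 2 = c - s.2.2 := by
        rw [hc, ← hzC]; simp only [PiLp.sub_apply]; ring
      rw [dist_eq_norm, h, eA, eB, eC]
    have hd1 : 1 ≤ dist y z ^ 2 := one_le_pow₀ hyz
    have hexp : (a - s.1) ^ 2 + (b - s.2.1) ^ 2 + (c - s.2.2) ^ 2 =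
        (a ^ 2 + b ^ 2 + c ^ 2) + ((s.1 : ℝ) ^ 2 + (s.2.1 : ℝ) ^ 2 + (s.2.2 : ℝ) ^ 2) -
          2 * (a * (s.1 : ℝ) + b * (s.2.1 : ℝ) + c * (s.2.2 : ℝ)) := by ring
    linarith [hsph, hd1, h2, hsn, hexp]
  obtain ⟨e1, e2, e3⟩ := cubicShell_single_vacancy a b c h2 v hv hslots
  -- equal cubic coordinates relative to `q` ⇒ equal points
  apply eq_of_cubic_sub_eq y z₀ q
  · rw [hvA, ← e1]
  · rw [hvB, ← e2]
  · rw [hvC, ← e3]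

/-- **Single-vacancy rigidity for a moved lattice `A·Λ₀ + t`** (both grains of a wall cell are of
this form): `q, z₀ ∈ A·Λ₀ + t` at distance `1`; a point touching `q` at distance `≥ 1` from every
other nearest-neighbour site of `q` in `A·Λ₀ + t` equals `z₀`. -/
theorem fcc_single_vacancy_moved
    (A : EuclideanSpace ℝ (Fin 3) ≃ₗᵢ[ℝ] EuclideanSpace ℝ (Fin 3)) (t : EuclideanSpace ℝ (Fin 3))
    (q y z₀ : EuclideanSpace ℝ (Fin 3))
    (hq : q ∈ (fun p => A p + t) '' fccStacking 1 (Real.sqrt (2 / 3)))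
    (hz₀ : z₀ ∈ (fun p => A p + t) '' fccStacking 1 (Real.sqrt (2 / 3)))
    (hqz₀ : dist q z₀ = 1) (hy : dist q y = 1)
    (h : ∀ z ∈ (fun p => A p + t) '' fccStacking 1 (Real.sqrt (2 / 3)), dist q z = 1 → z ≠ z₀ →
      1 ≤ dist y z) :
    y = z₀ := by
  set f : EuclideanSpace ℝ (Fin 3) → EuclideanSpace ℝ (Fin 3) := fun s => A.symm (s - t) with hf
  have hfd : ∀ u w, dist (f u) (f w) = dist u w := by
    intro u w; simp only [hf]; rw [LinearIsometryEquiv.dist_map, dist_sub_right]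
  have hfmem : ∀ u, u ∈ (fun p => A p + t) '' fccStacking 1 (Real.sqrt (2 / 3)) →
      f u ∈ fccStacking 1 (Real.sqrt (2 / 3)) := by
    rintro u ⟨p, hp, rfl⟩
    have : f (A p + t) = p := by simp [hf]
    rw [this]; exact hp
  have hfinv : ∀ p, f (A p + t) = p := fun p => by simp [hf]
  have key := fcc_single_vacancy (f q) (f y) (f z₀) (hfmem q hq) (hfmem z₀ hz₀)
    (by rw [hfd]; exact hqz₀) (by rw [hfd]; exact hy) (by
      intro z hz hqz hzz₀
      have hz' : A z + t ∈ (fun p => A p + t) '' fccStacking 1 (Real.sqrt (2 / 3)) := ⟨z, hz, rfl⟩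
      have h1 := h (A z + t) hz' (by rw [← hfd, hfinv]; exact hqz)
        (by intro hc; apply hzz₀; rw [← hfinv z, hc])
      rwa [← hfd, hfinv] at h1)
  have hinj : Function.Injective f := by
    intro u w huw
    have : u - t = w - t := A.symm.injective huw
    simpa using this
  exact hinj key

end Summit.Ventures.Crystal3D.Theorems

end
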